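import Literature.Probability.LatticeModels.GlauberLogSobolevMixing
import Literature.Probability.MarkovChains.IsingSpectralHighTemperatureLSIProof
import HarnessLib

/-!
# Finite-range pair potentials on `ℤ^d` at spectral high temperature: a log-Sobolev inequality uniform in
# the volume and the boundary condition (Bauerschmidt–Bodineau 2019), hence strong mixing and uniqueness
# (Martinelli 1999, Theorem 3.3) — PROVED

Topic `Literature/Probability/LatticeModels`; cell `ym-ir`, seat lit-3 (census rows B2/B4/B17 of
`pub/ym-ir/REDUCTION-CENSUS.md`).  THEOREMS ONLY (no named fact, D-0026) plus ONE definition with a body: the first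
concrete instance `FRPotential.pair` of the tree's finite-range translation-invariant potentials
(`StrongMixingFiniteSize.FRPotential`, [Mar99] Def 2.1, `H(σ) = −Σ_A J_A ∏_{x∈A} σ(x)` with `J_A = 0` unless
`|A| ≤ 2`), and its nearest-neighbour Ising specialisation `FRPotential.nnIsing`.
SIBLING-SETTING results (`±1` spins); nothing here is a statement about gauge theories, and the Yang–Mills mass gap is
not touched.

Sources (held, read this session):
* [BB19] R. Bauerschmidt, T. Bodineau, *A very simple proof of the LSI for high temperature spin systems*,
  J. Funct. Anal. 276 (2019) 2582–2588, arXiv:1712.03676 — Theorem 1 p.2 (`paper:arxiv-1712.03676` p0003 L44–55: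
  for the Ising case `n = 1`, `Ent_ν(F²) ≤ (2/γ)(1 + 2‖M‖/(1 − ‖M‖)) Σ_x ν(|∇_{σ_x}F|²)` with `2/γ = 1/2`,
  «a LSI uniformly with respect to the set `Λ`») and the spectral remark p0003 L63–69 («if `M` … has spectrum
  in `[λ⁻, λ⁺]` … the LSI holds under the spectral condition `λ⁺ − λ⁻ < n`»).  In the tree this is the
  DISCHARGED fact `SpectralIsing.BauerschmidtBodineau2019_logSobolev` (`…_holds`,
  `IsingSpectralHighTemperatureLSIProof.lean`; [BBD] Theorem 10). [cite: BauerschmidtBodineau2019, Theorem 1]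
* [Mar99] F. Martinelli, *Lectures on Glauber dynamics for discrete spin models*, LNM 1717 (1999): Def 2.1
  (finite-range translation-invariant potentials, `S = {−1,+1}`), (3.16)–(3.17) the log-Sobolev constant,
  Theorem 3.3 (b)–(c) (uniform log-Sobolev constant ⇒ `SMT` on all cubes + unique Gibbs measure) — the tree's
  DISCHARGED fact `Glauber.Martinelli1999_thm3_3` (`…_holds`, `GlauberLogSobolevMixing.lean`).
  [cite: Martinelli1999, Theorem 3.3]

## Contents (all proved; one definition family with bodies, no named fact)

* §1 `FRPotential.pairJ J x y = ½(J(y−x) + J(x−y))` (`0` on the diagonal), `FRPotential.pairU J h₀` (the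
  interaction: `U_{ {x} } = −h₀ σ_x`, `U_{ {x,y} } = −J̃_{xy} σ_x σ_y`, `U_A = 0` for `|A| ≥ 3`; `pairU_singleton`,
  `pairU_pair`, `isAdapted_pairU`), **`FRPotential.pair J h₀ hr : FRPotential d ℤˣ r`** for `J` vanishing beyond
  sup-distance `r` ([Mar99] Def 2.1: adapted, finite range, translation invariant — all proved).
* §2 `FRPotential.hamiltonianIn_pairU` (`H_Λ = −h₀ Σ_{x∈Λ} σ_x − ½ Σ_{x,y∈N_r(Λ), {x,y}∩Λ≠∅} J̃_{xy} σ_x σ_y`) and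
  `FRPotential.hamiltonianIn_pairU_glueWith`: `H_Λ(ζ τ_{Λᶜ}) = −Σ_{x∈Λ} ζ_x (h₀ + b_x(τ)) − ½ Σ_{x,y∈Λ} J̃_{xy} ζ_x ζ_y`
  with the boundary field `FRPotential.bfield J r Λ τ x = Σ_{y ∈ N_r(Λ)∖Λ} J̃_{xy} τ_y`.
* §3 `FRPotential.integral_spec_eq_sum` — for ANY `U : FRPotential d ℤˣ r` and measurable `F`:
  `μ_Λ^τ(F) = Σ_ζ e^{−βH_Λ(ζτ)} F(ζτ) / Σ_ζ e^{−βH_Λ(ζτ)}` ([MOS94] (1.4)).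
* §4 `Glauber.logSobolevIneq_of_integral_eq_sum` — transfer of `Ent_p(G) ≤ K·D_p(√G)` for a weight vector `p` on
  `{±1}^Λ` (finite-chain currency of `Literature/Probability/MarkovChains`, standard single-flip Dirichlet form) to
  the tree's `Glauber.LogSobolevIneq ν Λ (K/2)` for the glued measure on `{±1}^{ℤ^d}` ([Mar99] (3.16)).
* §5 `FRPotential.sum_abs_pairJ_le` (Gershgorin row sums `≤ S`), `FRPotential.abs_quadForm_pairJ_le`
  (`|(v, J̃_Λ v)| ≤ S|v|²`), `FRPotential.bbMatrix J S Λ = (S·1 − J̃_Λ)/(2S)` with `posSemidef_bbMatrix`,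
  `posSemidef_one_sub_bbMatrix` (spectrum in `[0,1]`), `FRPotential.exp_neg_mul_hamiltonianIn_pair_eq` (the Gibbs
  weights are `e^{βS|Λ|/2}` times the [BBD] (eq: Ising model-bis) weights with `A = bbMatrix`, `β′ = 2Sβ`, field
  `β(h₀ + b(τ))`), and the main theorem **`FRPotential.pair_logSobolevIneq`: for `0 < β`, `S ≥ Σ_{z≠0} |J z|`,
  `S > 0`, `2Sβ < 1`, EVERY finite-volume Gibbs measure satisfies `Glauber.LogSobolevIneq (μ_Λ^τ) Λ
  ((1 + 2β′/(1−β′))/2)`, `β′ = 2Sβ`, for ALL finite `Λ ⊂ ℤ^d` and ALL boundary conditions `τ`** ([BB19] Theorem 1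
  with `M = −βJ̃_Λ`, spectral width `≤ 2βS`); corollaries `FRPotential.pair_poincareIneq` (uniform gap `≥ c⁻¹`) and
  **`FRPotential.pair_SMT_unique`** (`SMT(B_L, l₀, α)` on all cubes with one `(l₀, α)` + a unique Gibbs measure,
  through the discharged [Mar99] Theorem 3.3).
* §6 `FRPotential.nnCoupling d Jc`, **`FRPotential.nnIsing d Jc h₀ : FRPotential d ℤˣ 1`** (nearest-neighbour
  Ising model on `ℤ^d`, coupling `J_c`, field `h₀`), `sum_abs_nnCoupling_le` (`Σ_{z≠0}|J z| ≤ 2d|J_c|`, the `2d`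
  neighbours — tree `card_neighborFinset_zdGraph_holds`), **`FRPotential.nnIsing_logSobolevIneq`** and
  **`FRPotential.nnIsing_SMT_unique`** under `4 d J_c β < 1` (`d ≥ 1`, `J_c > 0`, `β > 0`).

Normalisations: [BB19]/[BBD] `Ent(F) ≤ K·D(√F)` with `D(G) = ½ Σ_x E(G(σ)−G(σ^x))²`; [Mar99] (3.16)
`ν(f² log f) ≤ c·𝓔_Λ(f,f) + ν(f²) log √ν(f²)` with `𝓔_Λ(f,f) = ½ ν(|∇_Λ f|²)`; so `c = K/2` (and `gap ≥ 1/c`).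
HONEST FRAMING: a sibling-setting theorem (`±1` spins, pair interactions); the threshold `4dJ_cβ < 1` is [BB19]'s
spectral condition evaluated by Gershgorin, not a critical value; nothing here bears on lattice gauge theory.
-/

noncomputable section

open MeasureTheory ProbabilityTheory Finset
open Literature.Probability.MarkovChains
open scoped Matrix

namespace Literature.Probability.LatticeModels

variable {d r : ℕ}

namespace FRPotential

/-! ### §1. Finite-range pair potentials ([Mar99] Def 2.1 with `J_A = 0` for `|A| ≥ 3`) -/

/-- The symmetrised pair coupling `J̃_{xy} = ½(J(y−x) + J(x−y))` for `x ≠ y`, `0` on the diagonal (for an even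
`J` this is `J(y−x)`). [cite: Martinelli1999, Definition 2.1] -/
def pairJ (J : Site d → ℝ) (x y : Site d) : ℝ := if x = y then 0 else (J (y - x) + J (x - y)) / 2

/-- `J̃` is symmetric. [cite: Martinelli1999, Definition 2.1] -/
theorem pairJ_comm (J : Site d → ℝ) (x y : Site d) : pairJ J x y = pairJ J y x := by
  unfold pairJ
  by_cases h : x = y
  · subst h; simp
  · rw [if_neg h, if_neg (Ne.symm h), add_comm]

/-- `J̃_{xx} = 0`. [cite: Martinelli1999, Definition 2.1] -/
@[simp] theorem pairJ_self (J : Site d → ℝ) (x : Site d) : pairJ J x x = 0 := by simp [pairJ]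

/-- `J̃` is translation invariant. [cite: Martinelli1999, Definition 2.1 (H2)] -/
theorem pairJ_add_right (J : Site d → ℝ) (x y k : Site d) : pairJ J (x + k) (y + k) = pairJ J x y := by
  unfold pairJ
  simp only [add_left_inj, add_sub_add_right_eq_sub]

/-- The interaction of a PAIR potential with couplings `J` and field `h₀` ([Mar99] Def 2.1, `H = −Σ_A J_A ∏_{x∈A}
σ(x)`): `U_{ {x} }(σ) = −h₀ σ_x`, `U_{ {x,y} }(σ) = −J̃_{xy} σ_x σ_y`, and `U_A = 0` for `|A| ≥ 3` (and `A = ∅`).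
[cite: Martinelli1999, Definition 2.1] -/
def pairU (J : Site d → ℝ) (h₀ : ℝ) : Potential (Site d) ℤˣ := fun A σ =>
  if A.card = 1 then -(h₀ * ∑ x ∈ A, spinAt x σ)
  else if A.card = 2 then -((1 / 2) * ∑ x ∈ A, ∑ y ∈ A, pairJ J x y * (spinAt x σ * spinAt y σ))
  else 0

/-- The one-body term. [cite: Martinelli1999, Definition 2.1] -/
theorem pairU_singleton (J : Site d → ℝ) (h₀ : ℝ) (x : Site d) (σ : Site d → ℤˣ) :
    pairU J h₀ {x} σ = -(h₀ * spinAt x σ) := by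
  simp [pairU]

/-- The two-body term. [cite: Martinelli1999, Definition 2.1] -/
theorem pairU_pair (J : Site d → ℝ) (h₀ : ℝ) {x y : Site d} (hxy : x ≠ y) (σ : Site d → ℤˣ) :
    pairU J h₀ {x, y} σ = -(pairJ J x y * (spinAt x σ * spinAt y σ)) := by
  unfold pairU
  rw [if_neg (by rw [card_pair hxy]; norm_num), if_pos (card_pair hxy), sum_pair hxy, sum_pair hxy, sum_pair hxy]
  simp only [pairJ_self, zero_mul, zero_add, add_zero]
  rw [pairJ_comm J y x, mul_comm (spinAt y σ) (spinAt x σ)]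
  ring

/-- The interaction terms are local and measurable. [cite: Martinelli1999, Definition 2.1] -/
theorem isAdapted_pairU (J : Site d → ℝ) (h₀ : ℝ) : Potential.IsAdapted (pairU J h₀) := by
  intro A
  refine ⟨?_, ?_⟩
  · intro σ σ' hA
    have hs : ∀ x ∈ A, spinAt x σ = spinAt x σ' := fun x hx => by
      unfold spinAt; rw [hA x (Finset.mem_coe.2 hx)]
    unfold pairU
    have h1 : ∑ x ∈ A, spinAt x σ = ∑ x ∈ A, spinAt x σ' := sum_congr rfl hs
    have h2 : ∑ x ∈ A, ∑ y ∈ A, pairJ J x y * (spinAt x σ * spinAt y σ) =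
        ∑ x ∈ A, ∑ y ∈ A, pairJ J x y * (spinAt x σ' * spinAt y σ') :=
      sum_congr rfl fun x hx => sum_congr rfl fun y hy => by rw [hs x hx, hs y hy]
    rw [h1, h2]
  · unfold pairU
    split_ifs
    · exact ((Finset.measurable_sum _ fun x _ => measurable_spinAt x).const_mul _).neg
    · exact ((Finset.measurable_sum _ fun x _ => Finset.measurable_sum _ fun y _ =>
        ((measurable_spinAt x).mul (measurable_spinAt y)).const_mul _).const_mul _).neg
    · exact measurable_const

/-- **The pair potential** with translation-invariant couplings `J(y − x)` (symmetrised) of range `r` and constant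
field `h₀`, as a finite-range translation-invariant adapted potential on `{−1,+1}^{ℤ^d}` ([Mar99] Def 2.1; the
tree's `FRPotential`).  `hr`: `J(y − x) = 0` whenever `d(x,y) > r`. [cite: Martinelli1999, Definition 2.1] -/
def pair (J : Site d → ℝ) (h₀ : ℝ) (hr : ∀ x y : Site d, r < supDist x y → J (y - x) = 0) : FRPotential d ℤˣ r where
  U := pairU J h₀
  adapted := isAdapted_pairU J h₀
  range := by
    intro X hX
    obtain ⟨a, ha, b, hb, hab⟩ := hX
    have hne : a ≠ b := by rintro rfl; simp at hab
    funext σ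
    by_cases h2 : X.card = 2
    · have hsub : ({a, b} : Finset (Site d)) ⊆ X := by
        intro z hz
        rcases Finset.mem_insert.1 hz with rfl | hz
        · exact ha
        · rw [Finset.mem_singleton.1 hz]; exact hb
      have hX2 : X = {a, b} :=
        (Finset.eq_of_subset_of_card_le hsub (by rw [h2, card_pair hne])).symm
      rw [hX2, pairU_pair J h₀ hne]
      have hJ1 : J (b - a) = 0 := hr a b hab
      have hJ2 : J (a - b) = 0 := hr b a (by rwa [supDist_comm])
      simp [pairJ, hne, hJ1, hJ2]
    · have h1 : X.card ≠ 1 := by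
        intro h1
        obtain ⟨z, hz⟩ := Finset.card_eq_one.1 h1
        rw [hz, Finset.mem_singleton] at ha hb
        exact hne (ha.trans hb.symm)
      simp [pairU, h1, h2]
  shift := by
    intro k X σ
    have hinj : Set.InjOn (fun x : Site d => x + k) ↑X := fun x _ y _ h => add_right_cancel h
    have hcard : (X.image fun x => x + k).card = X.card := Finset.card_image_of_injOn hinj
    have hspin : ∀ x : Site d, spinAt (x + k) σ = spinAt x (fun y => σ (y + k)) := fun x => rfl
    unfold pairU
    rw [hcard, sum_image hinj, sum_image hinj]
    simp_rw [sum_image hinj, pairJ_add_right, hspin]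

/-- The interaction of `pair`. [cite: Martinelli1999, Definition 2.1] -/
@[simp] theorem pair_U (J : Site d → ℝ) (h₀ : ℝ) (hr : ∀ x y : Site d, r < supDist x y → J (y - x) = 0) :
    (pair J h₀ hr).U = pairU J h₀ := rfl

/-! ### §2. The Hamiltonian of a pair potential is a quadratic form in the spins -/

/-- The `r`-neighbourhood `⋃_{y∈Λ} {d(·,y) ≤ r}` of a finite volume (the sites the interaction sets of range `r`
meeting `Λ` can use). [cite: Martinelli1999, §2.1] -/
def nbhd (r : ℕ) (Λ : Finset (Site d)) : Finset (Site d) := Λ.biUnion fun y => rNeighbourhood r y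

/-- `Λ` lies in its own `r`-neighbourhood. [cite: Martinelli1999, §2.1] -/
theorem subset_nbhd (r : ℕ) (Λ : Finset (Site d)) : Λ ⊆ nbhd r Λ := fun x hx =>
  Finset.mem_biUnion.2 ⟨x, hx, mem_rNeighbourhood.2 (by simp)⟩

/-- **The Hamiltonian of the pair potential**: `H_Λ(σ) = −h₀ Σ_{x∈Λ} σ_x − ½ Σ_{x,y ∈ N_r(Λ), {x,y}∩Λ≠∅} J̃_{xy} σ_x
σ_y` (the interaction sets of cardinality `1` meeting `Λ` are the `{x}`, `x ∈ Λ`; those of cardinality `2` are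
the `{x,y} ⊆ N_r(Λ)` meeting `Λ`, each counted twice in the double sum). [cite: Martinelli1999, Definition 2.1 (2.2)] -/
theorem hamiltonianIn_pairU (J : Site d → ℝ) (h₀ : ℝ) (Λ : Finset (Site d)) (σ : Site d → ℤˣ) :
    hamiltonianIn (pairU J h₀) (interactionSets r) Λ σ =
      -(h₀ * ∑ x ∈ Λ, spinAt x σ) -
        (1 / 2) * ∑ x ∈ nbhd r Λ, ∑ y ∈ nbhd r Λ,
          (if (({x, y} : Finset (Site d)) ∩ Λ).Nonempty then pairJ J x y * (spinAt x σ * spinAt y σ) else 0) := by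
  classical
  set N := nbhd r Λ with hN
  set P : Finset (Site d) → Prop := fun A => (A ∩ Λ).Nonempty with hP
  set F := N.powerset.filter P with hF
  have hsum : hamiltonianIn (pairU J h₀) (interactionSets r) Λ σ = ∑ A ∈ F, pairU J h₀ A σ := by
    unfold hamiltonianIn interactionSets
    rw [hF, hN, Finset.filter_filter]
    unfold nbhd
    simp only [hP, and_self]
  rw [hsum]
  -- split the interaction into its one- and two-body parts
  set U1 : Finset (Site d) → ℝ := fun A => if A.card = 1 then ∑ x ∈ A, -(h₀ * spinAt x σ) else 0 with hU1
  set U2 : Finset (Site d) → ℝ := fun A =>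
    if A.card = 2 then ∑ x ∈ A, ∑ y ∈ A, -((1 / 2) * (pairJ J x y * (spinAt x σ * spinAt y σ))) else 0 with hU2
  have hsplit : ∀ A, pairU J h₀ A σ = U1 A + U2 A := by
    intro A
    simp only [hU1, hU2, pairU]
    by_cases h1 : A.card = 1
    · simp [h1, mul_sum, sum_neg_distrib]
    · by_cases h2 : A.card = 2
      · simp [h2, mul_sum, sum_neg_distrib]
      · simp [h1, h2]
  simp_rw [hsplit, sum_add_distrib]
  -- membership bookkeeping
  have hmemF : ∀ A, A ∈ F ↔ A ⊆ N ∧ P A := fun A => by rw [hF, mem_filter, mem_powerset]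
  have hΛN : Λ ⊆ N := subset_nbhd r Λ
  -- the one-body part
  have h1 : ∑ A ∈ F, U1 A = ∑ x ∈ Λ, -(h₀ * spinAt x σ) := by
    simp only [hU1]
    rw [← sum_filter]
    rw [sum_comm' (t' := N) (s' := fun x => (F.filter fun A => A.card = 1).filter fun A => x ∈ A)]
    · have hin : ∀ x ∈ N, ∑ A ∈ (F.filter fun A => A.card = 1).filter (fun A => x ∈ A), -(h₀ * spinAt x σ) =
          if x ∈ Λ then -(h₀ * spinAt x σ) else 0 := by
        intro x _
        have hset : (F.filter fun A => A.card = 1).filter (fun A => x ∈ A) = if x ∈ Λ then { {x} } else ∅ := by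
          ext A
          simp only [mem_filter, hmemF]
          constructor
          · rintro ⟨⟨⟨hAN, hPA⟩, hc⟩, hxA⟩
            obtain ⟨z, rfl⟩ := Finset.card_eq_one.1 hc
            rw [Finset.mem_singleton] at hxA
            subst hxA
            have hxΛ : x ∈ Λ := by
              obtain ⟨w, hw⟩ := hPA
              rw [mem_inter, Finset.mem_singleton] at hw
              rw [← hw.1]; exact hw.2
            rw [if_pos hxΛ]; exact Finset.mem_singleton.2 rfl
          · intro h
            by_cases hxΛ : x ∈ Λ
            · rw [if_pos hxΛ, Finset.mem_singleton] at h
              subst h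
              refine ⟨⟨⟨Finset.singleton_subset_iff.2 (hΛN hxΛ), ⟨x, ?_⟩⟩, card_singleton x⟩, Finset.mem_singleton_self x⟩
              exact mem_inter.2 ⟨Finset.mem_singleton_self x, hxΛ⟩
            · rw [if_neg hxΛ] at h; exact absurd h (Finset.notMem_empty A)
        rw [hset]
        split_ifs <;> simp
      rw [sum_congr rfl hin, ← sum_filter, Finset.filter_mem_eq_inter, Finset.inter_eq_right.2 hΛN]
    · intro A x
      simp only [mem_filter]
      constructor
      · rintro ⟨hA, hx⟩; exact ⟨⟨hA, hx⟩, ((hmemF A).1 hA.1).1 hx⟩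
      · rintro ⟨⟨hA, hx⟩, _⟩; exact ⟨hA, hx⟩
  -- the two-body part
  have h2 : ∑ A ∈ F, U2 A = ∑ x ∈ N, ∑ y ∈ N,
      (if (({x, y} : Finset (Site d)) ∩ Λ).Nonempty then -((1 / 2) * (pairJ J x y * (spinAt x σ * spinAt y σ))) else 0) := by
    simp only [hU2]
    rw [← sum_filter]
    set F2 := F.filter fun A => A.card = 2 with hF2
    have hmemF2 : ∀ A, A ∈ F2 ↔ (A ⊆ N ∧ P A) ∧ A.card = 2 := fun A => by rw [hF2, mem_filter, hmemF]
    rw [sum_comm' (t' := N) (s' := fun x => F2.filter fun A => x ∈ A)]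
    · refine sum_congr rfl fun x hx => ?_
      rw [sum_comm' (t' := N) (s' := fun y => (F2.filter fun A => x ∈ A).filter fun A => y ∈ A)]
      · refine sum_congr rfl fun y hy => ?_
        by_cases hxy : x = y
        · subst hxy; simp
        · have hset : (F2.filter fun A => x ∈ A).filter (fun A => y ∈ A) =
              if (({x, y} : Finset (Site d)) ∩ Λ).Nonempty then { {x, y} } else ∅ := by
            ext A
            simp only [mem_filter, hmemF2]
            constructor
            · rintro ⟨⟨⟨⟨hAN, hPA⟩, hc⟩, hxA⟩, hyA⟩
              have hsub : ({x, y} : Finset (Site d)) ⊆ A := by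
                intro z hz
                rcases Finset.mem_insert.1 hz with rfl | hz
                · exact hxA
                · rw [Finset.mem_singleton.1 hz]; exact hyA
              have hA : A = {x, y} := (Finset.eq_of_subset_of_card_le hsub (by rw [hc, card_pair hxy])).symm
              subst hA
              rw [if_pos hPA]; exact Finset.mem_singleton_self _
            · intro h
              by_cases hPxy : (({x, y} : Finset (Site d)) ∩ Λ).Nonempty
              · rw [if_pos hPxy, Finset.mem_singleton] at h
                subst h
                refine ⟨⟨⟨⟨?_, hPxy⟩, card_pair hxy⟩, Finset.mem_insert_self x {y}⟩,
                  Finset.mem_insert_of_mem (Finset.mem_singleton_self y)⟩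
                intro z hz
                rcases Finset.mem_insert.1 hz with rfl | hz
                · exact hx
                · rw [Finset.mem_singleton.1 hz]; exact hy
              · rw [if_neg hPxy] at h; exact absurd h (Finset.notMem_empty A)
          rw [hset]
          split_ifs <;> simp
      · intro A y
        simp only [mem_filter]
        constructor
        · rintro ⟨hA, hyA⟩; exact ⟨⟨hA, hyA⟩, ((hmemF2 A).1 hA.1).1.1 hyA⟩
        · rintro ⟨⟨hA, hyA⟩, _⟩; exact ⟨hA, hyA⟩
    · intro A x
      simp only [mem_filter]
      constructor
      · rintro ⟨hA, hx⟩; exact ⟨⟨hA, hx⟩, ((hmemF2 A).1 hA).1.1 hx⟩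
      · rintro ⟨⟨hA, hx⟩, _⟩; exact ⟨hA, hx⟩
  rw [h1, h2, sum_neg_distrib, ← mul_sum, mul_sum]
  congr 1
  rw [neg_eq_neg_one_mul, ← neg_eq_neg_one_mul]
  simp_rw [mul_sum]
  rw [← sum_neg_distrib]
  refine sum_congr rfl fun x _ => ?_
  rw [← sum_neg_distrib]
  refine sum_congr rfl fun y _ => ?_
  split_ifs <;> ring

/-- The boundary field felt at `x` from the frozen spins `τ` off `Λ`: `b_x(τ) = Σ_{y ∈ N_r(Λ) ∖ Λ} J̃_{xy} τ_y`.
[cite: Martinelli1999, §2.1 (2.1)] -/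
def bfield (J : Site d → ℝ) (r : ℕ) (Λ : Finset (Site d)) (τ : Site d → ℤˣ) (x : Site d) : ℝ :=
  ∑ y ∈ nbhd r Λ \ Λ, pairJ J x y * spinAt y τ

/-- Spins of a glued configuration inside `Λ`. [cite: Martinelli1999, §2.1] -/
theorem spinAt_glueWith_coe (Λ : Finset (Site d)) (ζ : ↥Λ → ℤˣ) (τ : Site d → ℤˣ) (x : ↥Λ) :
    spinAt (x : Site d) (glueWith Λ ζ τ) = SpectralIsing.spin ζ x := by
  unfold spinAt SpectralIsing.spin
  rw [glueWith_apply_mem Λ ζ τ x.2]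

/-- Spins of a glued configuration outside `Λ` are the boundary spins. [cite: Martinelli1999, §2.1] -/
theorem spinAt_glueWith_of_not_mem (Λ : Finset (Site d)) (ζ : ↥Λ → ℤˣ) (τ : Site d → ℤˣ) {y : Site d}
    (hy : y ∉ Λ) : spinAt y (glueWith Λ ζ τ) = spinAt y τ := by
  unfold spinAt
  rw [glueWith_apply_not_mem Λ ζ τ hy]

/-- **The Hamiltonian with boundary condition as a quadratic form in the interior spins**:
`H_Λ(ζ τ_{Λᶜ}) = −Σ_{x∈Λ} ζ_x (h₀ + b_x(τ)) − ½ Σ_{x,y∈Λ} J̃_{xy} ζ_x ζ_y`. [cite: Martinelli1999, Definition 2.1 (2.1)–(2.2)] -/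
theorem hamiltonianIn_pairU_glueWith (J : Site d → ℝ) (h₀ : ℝ) (Λ : Finset (Site d)) (ζ : ↥Λ → ℤˣ)
    (τ : Site d → ℤˣ) :
    hamiltonianIn (pairU J h₀) (interactionSets r) Λ (glueWith Λ ζ τ) =
      -(∑ x : ↥Λ, SpectralIsing.spin ζ x * (h₀ + bfield J r Λ τ x)) -
        (1 / 2) * ∑ x : ↥Λ, ∑ y : ↥Λ, pairJ J x y * (SpectralIsing.spin ζ x * SpectralIsing.spin ζ y) := by
  classical
  rw [hamiltonianIn_pairU]
  set σ := glueWith Λ ζ τ with hσ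
  set N := nbhd r Λ with hN
  have hΛN : Λ ⊆ N := subset_nbhd r Λ
  set g : Site d → Site d → ℝ := fun x y => pairJ J x y * (spinAt x σ * spinAt y σ) with hg
  have hgsymm : ∀ x y, g x y = g y x := fun x y => by simp only [hg, pairJ_comm J x y, mul_comm (spinAt x σ)]
  -- the four blocks of the double sum over `N = Λ ⊔ (N ∖ Λ)`
  have hPin : ∀ x ∈ Λ, ∀ y, (({x, y} : Finset (Site d)) ∩ Λ).Nonempty := fun x hx y =>
    ⟨x, mem_inter.2 ⟨mem_insert_self x {y}, hx⟩⟩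
  have hPin' : ∀ y ∈ Λ, ∀ x, (({x, y} : Finset (Site d)) ∩ Λ).Nonempty := fun y hy x =>
    ⟨y, mem_inter.2 ⟨mem_insert_of_mem (mem_singleton_self y), hy⟩⟩
  have hPout : ∀ x ∈ N \ Λ, ∀ y ∈ N \ Λ, ¬ (({x, y} : Finset (Site d)) ∩ Λ).Nonempty := by
    intro x hx y hy hne
    obtain ⟨z, hz⟩ := hne
    rw [mem_inter, mem_insert, Finset.mem_singleton] at hz
    rcases hz.1 with rfl | rfl
    · exact (mem_sdiff.1 hx).2 hz.2
    · exact (mem_sdiff.1 hy).2 hz.2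
  have hD : ∑ x ∈ N, ∑ y ∈ N, (if (({x, y} : Finset (Site d)) ∩ Λ).Nonempty then g x y else 0) =
      ∑ x ∈ Λ, ∑ y ∈ Λ, g x y + 2 * ∑ x ∈ Λ, ∑ y ∈ N \ Λ, g x y := by
    rw [← sum_sdiff hΛN]
    have hin : ∀ x ∈ Λ, ∑ y ∈ N, (if (({x, y} : Finset (Site d)) ∩ Λ).Nonempty then g x y else 0) =
        ∑ y ∈ N \ Λ, g x y + ∑ y ∈ Λ, g x y := by
      intro x hx
      rw [← sum_sdiff hΛN]
      congr 1
      · exact sum_congr rfl fun y _ => if_pos (hPin x hx y)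
      · exact sum_congr rfl fun y _ => if_pos (hPin x hx y)
    have hout : ∀ x ∈ N \ Λ, ∑ y ∈ N, (if (({x, y} : Finset (Site d)) ∩ Λ).Nonempty then g x y else 0) =
        ∑ y ∈ Λ, g x y := by
      intro x hx
      rw [← sum_sdiff hΛN]
      rw [sum_congr rfl fun y hy => if_neg (hPout x hx y hy), sum_const_zero, zero_add]
      exact sum_congr rfl fun y hy => if_pos (hPin' y hy x)
    rw [sum_congr rfl hin, sum_congr rfl hout, sum_add_distrib]
    have hswap : ∑ x ∈ N \ Λ, ∑ y ∈ Λ, g x y = ∑ x ∈ Λ, ∑ y ∈ N \ Λ, g x y := by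
      rw [sum_comm]
      exact sum_congr rfl fun x _ => sum_congr rfl fun y _ => hgsymm y x
    rw [hswap]
    ring
  rw [hD]
  -- identify the spins of the glued configuration
  have hfield : ∑ x ∈ Λ, spinAt x σ = ∑ x : ↥Λ, SpectralIsing.spin ζ x := by
    rw [← sum_coe_sort Λ]
    exact sum_congr rfl fun x _ => spinAt_glueWith_coe Λ ζ τ x
  have hii : ∑ x ∈ Λ, ∑ y ∈ Λ, g x y =
      ∑ x : ↥Λ, ∑ y : ↥Λ, pairJ J x y * (SpectralIsing.spin ζ x * SpectralIsing.spin ζ y) := by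
    rw [← sum_coe_sort Λ]
    refine sum_congr rfl fun x _ => ?_
    rw [← sum_coe_sort Λ]
    refine sum_congr rfl fun y _ => ?_
    simp only [hg, hσ, spinAt_glueWith_coe]
  have hio : ∑ x ∈ Λ, ∑ y ∈ N \ Λ, g x y = ∑ x : ↥Λ, SpectralIsing.spin ζ x * bfield J r Λ τ x := by
    rw [← sum_coe_sort Λ]
    refine sum_congr rfl fun x _ => ?_
    unfold bfield
    rw [← hN, mul_sum]
    refine sum_congr rfl fun y hy => ?_
    simp only [hg, hσ, spinAt_glueWith_coe, spinAt_glueWith_of_not_mem Λ ζ τ (mem_sdiff.1 hy).2]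
    ring
  rw [hfield, hii, hio]
  have hsum : ∑ x : ↥Λ, SpectralIsing.spin ζ x * (h₀ + bfield J r Λ τ x) =
      h₀ * ∑ x : ↥Λ, SpectralIsing.spin ζ x + ∑ x : ↥Λ, SpectralIsing.spin ζ x * bfield J r Λ τ x := by
    rw [mul_sum, ← sum_add_distrib]
    exact sum_congr rfl fun x _ => by ring
  rw [hsum]
  ring

/-! ### §3. Finite-volume Gibbs measures of a finite-range potential are explicit finite sums -/

/-- Integration against the glued counting measure `(count^{⊗Λ}) ∘ (ζ ↦ ζ τ_{Λᶜ})⁻¹` is a finite sum.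
[cite: MartinelliOlivieriSchonmann1994, §1 (1.4)] -/
theorem integral_map_glueWith_pi_count (Λ : Finset (Site d)) (τ : Site d → ℤˣ) {g : (Site d → ℤˣ) → ℝ}
    (hg : Measurable g) :
    ∫ σ, g σ ∂((Measure.pi fun _ : ↥Λ => (Measure.count : Measure ℤˣ)).map (glueWith Λ · τ)) =
      ∑ ζ : ↥Λ → ℤˣ, g (glueWith Λ ζ τ) := by
  rw [integral_map (measurable_glueWith Λ τ).aemeasurable hg.aestronglyMeasurable]
  rw [integral_fintype Integrable.of_finite]
  refine sum_congr rfl fun ζ _ => ?_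
  rw [measureReal_def, Measure.pi_singleton]
  simp

/-- **Finite-volume Gibbs expectations as finite sums** ([MOS94] (1.4); [Mar99] (2.1)): for measurable `F`,
`μ_Λ^τ(F) = Σ_ζ e^{−β H_Λ(ζ τ_{Λᶜ})} F(ζ τ_{Λᶜ}) / Σ_ζ e^{−β H_Λ(ζ τ_{Λᶜ})}`, the sums running over the
`2^{|Λ|}` configurations in `Λ`. [cite: MartinelliOlivieriSchonmann1994, §1 (1.4)] -/
theorem integral_spec_eq_sum (U : FRPotential d ℤˣ r) (β : ℝ) (Λ : Finset (Site d)) (τ : Site d → ℤˣ)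
    {F : (Site d → ℤˣ) → ℝ} (hF : Measurable F) :
    ∫ σ, F σ ∂(U.spec β Λ τ) =
      (∑ ζ : ↥Λ → ℤˣ, Real.exp (-β * hamiltonianIn U.U (interactionSets r) Λ (glueWith Λ ζ τ)) *
          F (glueWith Λ ζ τ)) /
        ∑ ζ : ↥Λ → ℤˣ, Real.exp (-β * hamiltonianIn U.U (interactionSets r) Λ (glueWith Λ ζ τ)) := by
  classical
  set H := hamiltonianIn U.U (interactionSets r) Λ with hH
  set φ : (Site d → ℤˣ) → ℝ := fun σ => -β * H σ with hφ
  set π : Measure (Site d → ℤˣ) :=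
    (Measure.pi fun _ : ↥Λ => (Measure.count : Measure ℤˣ)).map (glueWith Λ · τ) with hπ
  have hμ : U.spec β Λ τ = π.tilted φ := rfl
  have hφm : Measurable φ := (measurable_hamiltonianIn (fun A => (U.adapted A).2) _ Λ).const_mul _
  have hZ : ∫ σ, Real.exp (φ σ) ∂π = ∑ ζ : ↥Λ → ℤˣ, Real.exp (-β * H (glueWith Λ ζ τ)) :=
    integral_map_glueWith_pi_count Λ τ (Real.measurable_exp.comp hφm)
  rw [hμ, integral_tilted, hZ]
  have hm : Measurable fun σ => (Real.exp (φ σ) / ∑ ζ : ↥Λ → ℤˣ, Real.exp (-β * H (glueWith Λ ζ τ))) • F σ :=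
    ((Real.measurable_exp.comp hφm).div_const _).smul hF
  rw [integral_map_glueWith_pi_count Λ τ hm]
  simp only [smul_eq_mul, hφ]
  rw [sum_div]
  exact sum_congr rfl fun ζ _ => by ring

end FRPotential

/-! ### §4. Transfer: finite-chain log-Sobolev inequality ⇒ `Glauber.LogSobolevIneq` for the glued measure -/

namespace Glauber

/-- Gluing commutes with flipping an interior spin (`(ζ τ_{Λᶜ})^x = ζ^x τ_{Λᶜ}` for `x ∈ Λ`). [cite: Martinelli1999, §2.1] -/
theorem glueWith_flip (Λ : Finset (Site d)) (ζ : ↥Λ → ℤˣ) (τ : Site d → ℤˣ) (x : ↥Λ) :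
    glueWith Λ (SpectralIsing.flip x ζ) τ = spinFlip (x : Site d) (glueWith Λ ζ τ) := by
  funext y
  rw [spinFlip_apply]
  by_cases hy : y ∈ Λ
  · rw [glueWith_apply_mem Λ _ τ hy, glueWith_apply_mem Λ _ τ hy, SpectralIsing.flip_apply]
    by_cases hyx : (⟨y, hy⟩ : ↥Λ) = x
    · have hyx' : y = (x : Site d) := congrArg Subtype.val hyx
      rw [if_pos hyx, if_pos hyx', glueWith_apply_mem Λ ζ τ x.2]
    · have hyx' : y ≠ (x : Site d) := fun h => hyx (Subtype.ext h)
      rw [if_neg hyx, if_neg hyx']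
  · have hyx' : y ≠ (x : Site d) := fun h => hy (h ▸ x.2)
    rw [glueWith_apply_not_mem Λ _ τ hy, glueWith_apply_not_mem Λ _ τ hy, if_neg hyx']

/-- **Transfer lemma** ([Mar99] (3.16) vs. the standard single-flip Dirichlet form of [BBD] §2.1): if a measure
`ν` on `{±1}^{ℤ^d}` integrates measurable functions as `ν(F) = Σ_ζ p(ζ) F(ζ τ_{Λᶜ})` for a weight vector `p` on
`{±1}^Λ`, and `p` satisfies `Ent_p(G) ≤ K · D_p(√G)` for all `G ≥ 0` (`D_p` the standard Dirichlet form
`½ Σ_x E_p(G(ζ) − G(ζ^x))²`), then `ν(f² log f) ≤ (K/2) · ½ν(|∇_Λ f|²) + ν(f²) log √ν(f²)` for all bounded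
measurable positive `f`, i.e. `Glauber.LogSobolevIneq ν Λ (K/2)`. [cite: Martinelli1999, §3.5 (3.16)–(3.17)] -/
theorem logSobolevIneq_of_integral_eq_sum {Λ : Finset (Site d)} {τ : Site d → ℤˣ} {ν : Measure (Site d → ℤˣ)}
    {p : (↥Λ → ℤˣ) → ℝ}
    (hν : ∀ F : (Site d → ℤˣ) → ℝ, Measurable F → ∫ σ, F σ ∂ν = ∑ ζ, p ζ * F (glueWith Λ ζ τ))
    {K : ℝ} (hK : ∀ G : (↥Λ → ℤˣ) → ℝ, (∀ ζ, 0 ≤ G ζ) →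
      SpectralIsing.ent p G ≤ K * MarkovChains.dirichletForm p SpectralIsing.flipKernel (fun ζ => Real.sqrt (G ζ))) :
    LogSobolevIneq ν Λ (K / 2) := by
  classical
  intro f hf _ hpos
  set G : (↥Λ → ℤˣ) → ℝ := fun ζ => f (glueWith Λ ζ τ) ^ 2 with hGdef
  have hsqrt : ∀ ζ, Real.sqrt (G ζ) = f (glueWith Λ ζ τ) := fun ζ => Real.sqrt_sq (hpos _).le
  have hG := hK G (fun ζ => sq_nonneg _)
  -- the pieces of the inequality as finite sums
  have i1 : ∫ σ, f σ ^ 2 * Real.log (f σ) ∂ν = ∑ ζ, p ζ * (f (glueWith Λ ζ τ) ^ 2 * Real.log (f (glueWith Λ ζ τ))) :=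
    hν _ ((hf.pow_const 2).mul (Real.measurable_log.comp hf))
  have i2 : ∫ σ, f σ ^ 2 ∂ν = ∑ ζ, p ζ * f (glueWith Λ ζ τ) ^ 2 := hν _ (hf.pow_const 2)
  have i3 : dirichletForm ν Λ f = MarkovChains.dirichletForm p SpectralIsing.flipKernel (fun ζ => Real.sqrt (G ζ)) := by
    unfold Glauber.dirichletForm
    rw [hν _ (measurable_gradSq Λ hf), SpectralIsing.dirichletForm_flipKernel]
    congr 1
    refine sum_congr rfl fun ζ _ => ?_
    congr 1
    unfold gradSq siteGrad
    rw [← sum_coe_sort Λ]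
    refine sum_congr rfl fun x _ => ?_
    rw [hsqrt, hsqrt, glueWith_flip]
    ring
  -- entropy of `G = (f ∘ glue)²`
  have hent : SpectralIsing.ent p G =
      2 * ∑ ζ, p ζ * (f (glueWith Λ ζ τ) ^ 2 * Real.log (f (glueWith Λ ζ τ))) -
        (∑ ζ, p ζ * f (glueWith Λ ζ τ) ^ 2) * Real.log (∑ ζ, p ζ * f (glueWith Λ ζ τ) ^ 2) := by
    unfold SpectralIsing.ent
    simp only [hGdef, Real.log_pow, Nat.cast_ofNat]
    congr 1
    rw [mul_sum]
    exact sum_congr rfl fun ζ _ => by ring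
  have hm0 : 0 ≤ ∫ σ, f σ ^ 2 ∂ν := integral_nonneg fun σ => sq_nonneg _
  rw [Real.log_sqrt hm0, i1, i3]
  rw [i2] at hm0 ⊢
  rw [hent] at hG
  have : (∑ ζ, p ζ * f (glueWith Λ ζ τ) ^ 2) * (Real.log (∑ ζ, p ζ * f (glueWith Λ ζ τ) ^ 2) / 2) =
      ((∑ ζ, p ζ * f (glueWith Λ ζ τ) ^ 2) * Real.log (∑ ζ, p ζ * f (glueWith Λ ζ τ) ^ 2)) / 2 := by ring
  rw [this]
  have hK2 : K / 2 * MarkovChains.dirichletForm p SpectralIsing.flipKernel (fun ζ => Real.sqrt (G ζ)) =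
      (K * MarkovChains.dirichletForm p SpectralIsing.flipKernel (fun ζ => Real.sqrt (G ζ))) / 2 := by ring
  rw [hK2]
  linarith

end Glauber

/-! ### §5. The log-Sobolev inequality for pair potentials at spectral high temperature ([BB19] Theorem 1) -/

namespace FRPotential

section Main

variable (J : Site d → ℝ) (h₀ : ℝ) (hr : ∀ x y : Site d, r < supDist x y → J (y - x) = 0)

/-- Sup-distance is translation invariant: `d(y − x, 0) = d(y, x)`. [cite: Martinelli1999, §2.1] -/
theorem supDist_sub_zero (x y : Site d) : supDist (y - x) 0 = supDist y x := by
  simp [supDist]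

include hr in
/-- **Gershgorin row sums**: `Σ_{y∈Λ} |J̃_{xy}| ≤ Σ_{z≠0, d(z,0)≤r} |J z|` (the bound that puts the spectrum of `J̃_Λ` in
`[−S, S]`). [cite: BauerschmidtBodineau2019, Theorem 1 (remark on the spectral condition)] -/
theorem sum_abs_pairJ_le {S : ℝ} (hS : ∑ z ∈ (rNeighbourhood r 0).erase 0, |J z| ≤ S) (Λ : Finset (Site d))
    (x : Site d) : ∑ y ∈ Λ, |pairJ J x y| ≤ S := by
  classical
  set R := (rNeighbourhood r (0 : Site d)).erase 0 with hR
  have hJ0 : ∀ z : Site d, z ≠ 0 → z ∉ R → J z = 0 := by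
    intro z hz hzR
    have hfar : ¬ supDist z 0 ≤ r := fun h => hzR (mem_erase.2 ⟨hz, mem_rNeighbourhood.2 h⟩)
    have := hr 0 z (by rw [supDist_comm]; exact not_le.1 hfar)
    simpa using this
  -- a translated sum of `|J|` over nonzero differences is bounded by the sum over `R`
  have key : ∀ (e : Site d → Site d), Set.InjOn e ↑(Λ.erase x) → (∀ y ∈ Λ.erase x, e y ≠ 0) →
      ∑ y ∈ Λ.erase x, |J (e y)| ≤ S := by
    intro e he hne
    rw [← sum_image (f := fun z => |J z|) he]
    set Z := (Λ.erase x).image e with hZ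
    have h0Z : ∀ z ∈ Z, z ≠ 0 := by
      intro z hz
      obtain ⟨y, hy, rfl⟩ := mem_image.1 hz
      exact hne y hy
    have hsplit : ∑ z ∈ Z, |J z| = ∑ z ∈ Z.filter (fun z => z ∈ R), |J z| := by
      rw [sum_filter_of_ne]
      intro z hz hJz
      by_contra hzR
      exact hJz (by rw [hJ0 z (h0Z z hz) hzR, abs_zero])
    rw [hsplit]
    refine le_trans (sum_le_sum_of_subset_of_nonneg (fun z hz => (mem_filter.1 hz).2) fun _ _ _ => abs_nonneg _) hS
  have h1 : ∑ y ∈ Λ.erase x, |J (y - x)| ≤ S :=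
    key (fun y => y - x) (fun a _ b _ h => sub_left_injective h) fun y hy => sub_ne_zero.2 (mem_erase.1 hy).1
  have h2 : ∑ y ∈ Λ.erase x, |J (x - y)| ≤ S :=
    key (fun y => x - y) (fun a _ b _ h => sub_right_injective h)
      fun y hy => sub_ne_zero.2 (Ne.symm (mem_erase.1 hy).1)
  -- assemble
  have hx : ∑ y ∈ Λ, |pairJ J x y| = ∑ y ∈ Λ.erase x, |pairJ J x y| := by
    by_cases hxΛ : x ∈ Λ
    · rw [← Finset.sum_erase_add Λ _ hxΛ, pairJ_self, abs_zero, add_zero]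
    · rw [Finset.erase_eq_of_notMem hxΛ]
  rw [hx]
  have hle : ∀ y ∈ Λ.erase x, |pairJ J x y| ≤ (|J (y - x)| + |J (x - y)|) / 2 := by
    intro y hy
    unfold pairJ
    rw [if_neg (Ne.symm (mem_erase.1 hy).1), abs_div, abs_two]
    exact div_le_div_of_nonneg_right (abs_add_le _ _) zero_le_two
  calc ∑ y ∈ Λ.erase x, |pairJ J x y| ≤ ∑ y ∈ Λ.erase x, (|J (y - x)| + |J (x - y)|) / 2 := sum_le_sum hle
    _ = (∑ y ∈ Λ.erase x, |J (y - x)| + ∑ y ∈ Λ.erase x, |J (x - y)|) / 2 := by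
      rw [← sum_add_distrib, sum_div]
    _ ≤ (S + S) / 2 := div_le_div_of_nonneg_right (add_le_add h1 h2) zero_le_two
    _ = S := by ring

/-- **The quadratic-form bound behind the spectral condition**: `|Σ_{x,y∈Λ} J̃_{xy} v_x v_y| ≤ S Σ_x v_x²` when
the row sums of `|J̃|` are at most `S` (so the spectrum of `J̃_Λ` lies in `[−S, S]`, width `2S`).
[cite: BauerschmidtBodineau2019, Theorem 1 (remark on the spectral condition)] -/
theorem abs_quadForm_pairJ_le {S : ℝ} (hrow : ∀ (Λ : Finset (Site d)) (x : Site d), ∑ y ∈ Λ, |pairJ J x y| ≤ S)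
    (Λ : Finset (Site d)) (v : ↥Λ → ℝ) :
    |∑ x : ↥Λ, ∑ y : ↥Λ, pairJ J x y * (v x * v y)| ≤ S * ∑ x : ↥Λ, v x ^ 2 := by
  have hrow' : ∀ x : ↥Λ, ∑ y : ↥Λ, |pairJ J x y| ≤ S := fun x => by
    rw [show ∑ y : ↥Λ, |pairJ J x y| = ∑ y ∈ Λ, |pairJ J x y| from sum_coe_sort Λ (fun y => |pairJ J x y|)]
    exact hrow Λ x
  have hsplit : ∑ x : ↥Λ, ∑ y : ↥Λ, |pairJ J x y| * ((v x ^ 2 + v y ^ 2) / 2) =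
      (∑ x : ↥Λ, v x ^ 2 * ∑ y : ↥Λ, |pairJ J x y|) / 2 + (∑ y : ↥Λ, v y ^ 2 * ∑ x : ↥Λ, |pairJ J x y|) / 2 := by
    have h1 : ∑ x : ↥Λ, ∑ y : ↥Λ, |pairJ J x y| * ((v x ^ 2 + v y ^ 2) / 2) =
        ∑ x : ↥Λ, ∑ y : ↥Λ, |pairJ J x y| * v x ^ 2 / 2 + ∑ x : ↥Λ, ∑ y : ↥Λ, |pairJ J x y| * v y ^ 2 / 2 := by
      rw [← sum_add_distrib]
      refine sum_congr rfl fun x _ => ?_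
      rw [← sum_add_distrib]
      exact sum_congr rfl fun y _ => by ring
    rw [h1, sum_comm (f := fun (x : ↥Λ) (y : ↥Λ) => |pairJ J x y| * v y ^ 2 / 2)]
    congr 1
    · rw [sum_div]
      refine sum_congr rfl fun x _ => ?_
      rw [mul_sum, sum_div]
      exact sum_congr rfl fun y _ => by ring
    · rw [sum_div]
      refine sum_congr rfl fun y _ => ?_
      rw [mul_sum, sum_div]
      exact sum_congr rfl fun x _ => by ring
  have hb1 : ∑ x : ↥Λ, v x ^ 2 * ∑ y : ↥Λ, |pairJ J x y| ≤ ∑ x : ↥Λ, v x ^ 2 * S :=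
    sum_le_sum fun x _ => mul_le_mul_of_nonneg_left (hrow' x) (sq_nonneg _)
  have hb2 : ∑ y : ↥Λ, v y ^ 2 * ∑ x : ↥Λ, |pairJ J x y| ≤ ∑ y : ↥Λ, v y ^ 2 * S := by
    refine sum_le_sum fun y _ => mul_le_mul_of_nonneg_left ?_ (sq_nonneg _)
    rw [show ∑ x : ↥Λ, |pairJ J x y| = ∑ x : ↥Λ, |pairJ J y x| from sum_congr rfl fun x _ => by rw [pairJ_comm]]
    exact hrow' y
  have hS : ∑ x : ↥Λ, v x ^ 2 * S = S * ∑ x : ↥Λ, v x ^ 2 := by rw [mul_sum]; exact sum_congr rfl fun x _ => by ring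
  calc |∑ x : ↥Λ, ∑ y : ↥Λ, pairJ J x y * (v x * v y)|
      ≤ ∑ x : ↥Λ, |∑ y : ↥Λ, pairJ J x y * (v x * v y)| := abs_sum_le_sum_abs _ _
    _ ≤ ∑ x : ↥Λ, ∑ y : ↥Λ, |pairJ J x y| * ((v x ^ 2 + v y ^ 2) / 2) := by
      refine sum_le_sum fun x _ => (abs_sum_le_sum_abs _ _).trans (sum_le_sum fun y _ => ?_)
      rw [abs_mul]
      refine mul_le_mul_of_nonneg_left ?_ (abs_nonneg _)
      rw [abs_mul]
      nlinarith [sq_nonneg (|v x| - |v y|), sq_abs (v x), sq_abs (v y), abs_nonneg (v x), abs_nonneg (v y)]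
    _ ≤ S * ∑ x : ↥Λ, v x ^ 2 := by rw [hsplit]; linarith

/-- The coupling matrix in the [BB19]/[BBD] normalisation: `A = (S·1 − J̃_Λ)/(2S)` (spectrum in `[0,1]`).
[cite: BauerschmidtBodineau2019, Theorem 1 (remark on the spectral condition)] -/
def bbMatrix (S : ℝ) (Λ : Finset (Site d)) : Matrix ↥Λ ↥Λ ℝ :=
  fun x y => ((if x = y then S else 0) - pairJ J x y) / (2 * S)

/-- `A` is positive semidefinite. [cite: BauerschmidtBodineau2019, Theorem 1 (remark on the spectral condition)] -/
theorem posSemidef_bbMatrix {S : ℝ} (hS0 : 0 < S)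
    (hrow : ∀ (Λ : Finset (Site d)) (x : Site d), ∑ y ∈ Λ, |pairJ J x y| ≤ S) (Λ : Finset (Site d)) :
    (bbMatrix J S Λ).PosSemidef := by
  classical
  refine Matrix.PosSemidef.of_dotProduct_mulVec_nonneg ?_ fun v => ?_
  · refine Matrix.IsHermitian.ext fun x y => ?_
    simp only [bbMatrix, star_trivial, pairJ_comm J (y : Site d) x]
    by_cases h : x = y
    · subst h; rfl
    · rw [if_neg h, if_neg (Ne.symm h)]
  · have hq := abs_quadForm_pairJ_le J hrow Λ v
    have h2S : 0 < 2 * S := by positivity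
    have hx : ∀ x : ↥Λ, 2 * S * (v x * ∑ y : ↥Λ, ((if x = y then S else 0) - pairJ J x y) / (2 * S) * v y) =
        S * v x ^ 2 - ∑ y : ↥Λ, pairJ J x y * (v x * v y) := by
      intro x
      rw [mul_sum, mul_sum]
      have hy : ∀ y : ↥Λ, 2 * S * (v x * (((if x = y then S else 0) - pairJ J x y) / (2 * S) * v y)) =
          (if x = y then v x * S * v y else 0) - pairJ J x y * (v x * v y) := by
        intro y
        split_ifs <;> first | (field_simp; done) | (field_simp; ring)
      rw [sum_congr rfl fun y _ => hy y, sum_sub_distrib, sum_ite_eq, if_pos (mem_univ x)]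
      ring
    have hform : 2 * S * (star v ⬝ᵥ (bbMatrix J S Λ *ᵥ v)) =
        S * ∑ x : ↥Λ, v x ^ 2 - ∑ x : ↥Λ, ∑ y : ↥Λ, pairJ J x y * (v x * v y) := by
      simp only [dotProduct, Matrix.mulVec, star_trivial, bbMatrix]
      rw [mul_sum, sum_congr rfl fun x _ => hx x, sum_sub_distrib, ← mul_sum]
    refine (mul_nonneg_iff_of_pos_left h2S).1 ?_
    rw [hform]
    linarith [(abs_le.1 hq).2]

/-- `1 − A` is positive semidefinite. [cite: BauerschmidtBodineau2019, Theorem 1 (remark on the spectral condition)] -/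
theorem posSemidef_one_sub_bbMatrix {S : ℝ} (hS0 : 0 < S)
    (hrow : ∀ (Λ : Finset (Site d)) (x : Site d), ∑ y ∈ Λ, |pairJ J x y| ≤ S) (Λ : Finset (Site d)) :
    (1 - bbMatrix J S Λ).PosSemidef := by
  classical
  have hS0' : S ≠ 0 := hS0.ne'
  have hentry : ∀ x y : ↥Λ, (1 - bbMatrix J S Λ) x y = ((if x = y then S else 0) + pairJ J x y) / (2 * S) := by
    intro x y
    rw [Matrix.sub_apply, Matrix.one_apply]
    unfold bbMatrix
    by_cases h : x = y
    · rw [if_pos h, if_pos h, h, pairJ_self]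
      field_simp
      ring
    · rw [if_neg h, if_neg h]
      ring
  refine Matrix.PosSemidef.of_dotProduct_mulVec_nonneg ?_ fun v => ?_
  · refine Matrix.IsHermitian.ext fun x y => ?_
    rw [star_trivial, hentry, hentry, pairJ_comm J (y : Site d) x]
    by_cases h : x = y
    · subst h; rfl
    · rw [if_neg h, if_neg (Ne.symm h)]
  · have hq := abs_quadForm_pairJ_le J hrow Λ v
    have h2S : 0 < 2 * S := by positivity
    have hx : ∀ x : ↥Λ, 2 * S * (v x * ∑ y : ↥Λ, ((if x = y then S else 0) + pairJ J x y) / (2 * S) * v y) =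
        S * v x ^ 2 + ∑ y : ↥Λ, pairJ J x y * (v x * v y) := by
      intro x
      rw [mul_sum, mul_sum]
      have hy : ∀ y : ↥Λ, 2 * S * (v x * (((if x = y then S else 0) + pairJ J x y) / (2 * S) * v y)) =
          (if x = y then v x * S * v y else 0) + pairJ J x y * (v x * v y) := by
        intro y
        split_ifs <;> first | (field_simp; done) | (field_simp; ring)
      rw [sum_congr rfl fun y _ => hy y, sum_add_distrib, sum_ite_eq, if_pos (mem_univ x)]
      ring
    have hform : 2 * S * (star v ⬝ᵥ ((1 - bbMatrix J S Λ) *ᵥ v)) =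
        S * ∑ x : ↥Λ, v x ^ 2 + ∑ x : ↥Λ, ∑ y : ↥Λ, pairJ J x y * (v x * v y) := by
      simp only [dotProduct, Matrix.mulVec, star_trivial]
      simp_rw [hentry]
      rw [mul_sum, sum_congr rfl fun x _ => hx x, sum_add_distrib, ← mul_sum]
    refine (mul_nonneg_iff_of_pos_left h2S).1 ?_
    rw [hform]
    linarith [(abs_le.1 hq).1]

/-- Spins square to one (`σ_x² = 1`, the invariance under `A → A + α·id`). [cite: BauerschmidtBodineauDagallier2023, §6.4.1] -/
theorem spin_sq {ι : Type*} (ζ : ι → ℤˣ) (x : ι) : SpectralIsing.spin ζ x ^ 2 = 1 := by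
  unfold SpectralIsing.spin
  rcases Int.units_eq_one_or (ζ x) with h | h <;> simp [h]

/-- **The Boltzmann weights of a pair potential are those of [BBD] (eq: Ising model-bis)** with `A = (S·1 − J̃_Λ)/(2S)`,
`β′ = 2Sβ` and field `h′_x = β (h₀ + b_x(τ))`, up to the constant `e^{βS|Λ|/2}`:
`e^{−β H_Λ(ζτ)} = e^{βS|Λ|/2} · exp(−½ β′ (ζ, A ζ) + (h′, ζ))`. [cite: BauerschmidtBodineau2019, Theorem 1 (proof)] -/
theorem exp_neg_mul_hamiltonianIn_pair_eq {S : ℝ} (hS0 : S ≠ 0) (β : ℝ) (Λ : Finset (Site d)) (τ : Site d → ℤˣ)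
    (ζ : ↥Λ → ℤˣ) :
    Real.exp (-β * hamiltonianIn (pair J h₀ hr).U (interactionSets r) Λ (glueWith Λ ζ τ)) =
      Real.exp (β * S * Λ.card / 2) *
        SpectralIsing.weight (bbMatrix J S Λ) (fun x => β * (h₀ + bfield J r Λ τ x)) (2 * S * β) ζ := by
  classical
  have hQ : ∑ x : ↥Λ, ∑ y : ↥Λ, SpectralIsing.spin ζ x * bbMatrix J S Λ x y * SpectralIsing.spin ζ y =
      (S * Λ.card - ∑ x : ↥Λ, ∑ y : ↥Λ, pairJ J x y * (SpectralIsing.spin ζ x * SpectralIsing.spin ζ y)) / (2 * S) := by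
    unfold bbMatrix
    have hdiag : ∑ x : ↥Λ, ∑ y : ↥Λ, SpectralIsing.spin ζ x * (if x = y then S else 0) * SpectralIsing.spin ζ y =
        S * Λ.card := by
      have : ∀ x : ↥Λ, ∑ y : ↥Λ, SpectralIsing.spin ζ x * (if x = y then S else 0) * SpectralIsing.spin ζ y = S := by
        intro x
        rw [Finset.sum_eq_single x]
        · rw [if_pos rfl, show SpectralIsing.spin ζ x * S * SpectralIsing.spin ζ x = S * SpectralIsing.spin ζ x ^ 2 by ring,
            spin_sq, mul_one]
        · intro y _ hyx; rw [if_neg (Ne.symm hyx)]; ring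
        · intro h; exact absurd (mem_univ x) h
      rw [sum_congr rfl fun x _ => this x, sum_const, card_univ, Fintype.card_coe, nsmul_eq_mul, mul_comm]
    rw [sub_div, ← hdiag, sum_div, sum_div, ← sum_sub_distrib]
    refine sum_congr rfl fun x _ => ?_
    rw [sum_div, sum_div, ← sum_sub_distrib]
    refine sum_congr rfl fun y _ => ?_
    field_simp
  have hlin : ∑ x : ↥Λ, β * (h₀ + bfield J r Λ τ x) * SpectralIsing.spin ζ x =
      β * ∑ x : ↥Λ, SpectralIsing.spin ζ x * (h₀ + bfield J r Λ τ x) := by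
    rw [mul_sum]
    exact sum_congr rfl fun x _ => by ring
  rw [pair_U, hamiltonianIn_pairU_glueWith]
  simp only [SpectralIsing.weight]
  rw [← Real.exp_add, hQ, hlin]
  congr 1
  field_simp
  ring

/-- **[BB19] Theorem 1 for finite-range pair potentials on `ℤ^d` — a log-Sobolev inequality uniform in the volume and
in the boundary condition.**  Let `J` have range `r`, `S ≥ Σ_{0 < d(z,0) ≤ r} |J z|` (`S > 0`), `0 < β` and
`β′ := 2Sβ < 1`.  Then for EVERY finite `Λ ⊂ ℤ^d` and EVERY boundary condition `τ`, the finite-volume Gibbs measure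
`μ_Λ^τ` of the pair potential satisfies `μ_Λ^τ(f² log f) ≤ c · ½ μ_Λ^τ(|∇_Λ f|²) + μ_Λ^τ(f²) log √μ_Λ^τ(f²)` with
`c = (1 + 2β′/(1−β′))/2`, i.e. `sup_Λ sup_τ c_s(μ_Λ^τ) ≤ c` ([Mar99] (3.17)).  Proof: the spins in `Λ` under `μ_Λ^τ`
have the law (eq: Ising model-bis) with `A = (S·1 − J̃_Λ)/(2S)` — spectrum in `[0,1]` by the Gershgorin bound
`spec(J̃_Λ) ⊆ [−S, S]` — inverse temperature `β′` and field `β(h₀ + b(τ))`, so the discharged [BBD] Theorem 10 /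
[BB19] Theorem 1 applies with constant `1 + 2β′/(1−β′)` for `Ent(F) ≤ K D(√F)`, which is `K/2` in Martinelli's
normalisation. [cite: BauerschmidtBodineau2019, Theorem 1] -/
theorem pair_logSobolevIneq {S β : ℝ} (hS : ∑ z ∈ (rNeighbourhood r 0).erase 0, |J z| ≤ S) (hS0 : 0 < S)
    (hβ : 0 < β) (hβS : 2 * S * β < 1) (Λ : Finset (Site d)) (τ : Site d → ℤˣ) :
    Glauber.LogSobolevIneq ((pair J h₀ hr).spec β Λ τ) Λ ((1 + 2 * (2 * S * β) / (1 - 2 * S * β)) / 2) := by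
  classical
  have hrow := sum_abs_pairJ_le J hr hS
  set A := bbMatrix J S Λ with hA
  set h' : ↥Λ → ℝ := fun x => β * (h₀ + bfield J r Λ τ x) with hh'
  set β' := 2 * S * β with hβ'
  have hβ'0 : 0 < β' := by positivity
  set p := SpectralIsing.law A h' β' with hp
  refine Glauber.logSobolevIneq_of_integral_eq_sum (p := p) (τ := τ) ?_ ?_
  · intro F hF
    rw [integral_spec_eq_sum _ β Λ τ hF]
    set C := Real.exp (β * S * Λ.card / 2) with hCdef
    have hC : C ≠ 0 := (Real.exp_pos _).ne'
    have hw : ∀ ζ : ↥Λ → ℤˣ,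
        Real.exp (-β * hamiltonianIn (pair J h₀ hr).U (interactionSets r) Λ (glueWith Λ ζ τ)) =
          C * SpectralIsing.weight A h' β' ζ :=
      fun ζ => exp_neg_mul_hamiltonianIn_pair_eq J h₀ hr hS0.ne' β Λ τ ζ
    have hnum : ∑ ζ : ↥Λ → ℤˣ,
        Real.exp (-β * hamiltonianIn (pair J h₀ hr).U (interactionSets r) Λ (glueWith Λ ζ τ)) * F (glueWith Λ ζ τ) =
          C * ∑ ζ : ↥Λ → ℤˣ, SpectralIsing.weight A h' β' ζ * F (glueWith Λ ζ τ) := by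
      rw [mul_sum]
      exact sum_congr rfl fun ζ _ => by rw [hw ζ, mul_assoc]
    have hden : ∑ ζ : ↥Λ → ℤˣ,
        Real.exp (-β * hamiltonianIn (pair J h₀ hr).U (interactionSets r) Λ (glueWith Λ ζ τ)) =
          C * ∑ ζ : ↥Λ → ℤˣ, SpectralIsing.weight A h' β' ζ := by
      rw [mul_sum]
      exact sum_congr rfl fun ζ _ => hw ζ
    rw [hnum, hden, mul_div_mul_left _ _ hC, sum_div]
    refine sum_congr rfl fun ζ _ => ?_
    simp only [hp, SpectralIsing.law, SpectralIsing.Z]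
    ring
  · intro G hG
    exact SpectralIsing.BauerschmidtBodineau2019_logSobolev_holds (↥Λ) A h' β'
      (posSemidef_bbMatrix J hS0 hrow Λ) (posSemidef_one_sub_bbMatrix J hS0 hrow Λ) hβ'0 hβS G hG

/-- **Uniform spectral gap** ([Mar99] p0171 L31–33, `gap ≥ c_s⁻¹`): under the hypotheses of `pair_logSobolevIneq`,
`gap(L_Λ^τ) ≥ c⁻¹` for all finite `Λ` and all `τ`. [cite: Martinelli1999, Theorem 3.3 (proof)] -/
theorem pair_poincareIneq {S β : ℝ} (hS : ∑ z ∈ (rNeighbourhood r 0).erase 0, |J z| ≤ S) (hS0 : 0 < S)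
    (hβ : 0 < β) (hβS : 2 * S * β < 1) (Λ : Finset (Site d)) (τ : Site d → ℤˣ) :
    Glauber.PoincareIneq ((pair J h₀ hr).spec β Λ τ) Λ ((1 + 2 * (2 * S * β) / (1 - 2 * S * β)) / 2)⁻¹ := by
  haveI := ((pair J h₀ hr).isSpecification_spec β).isProbability Λ τ
  have h1 : 0 < 1 - 2 * S * β := by linarith
  have hc : 0 < (1 + 2 * (2 * S * β) / (1 - 2 * S * β)) / 2 := by positivity
  exact Glauber.LogSobolevIneq.poincareIneq hc (pair_logSobolevIneq J h₀ hr hS hS0 hβ hβS Λ τ)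

/-- **Strong mixing and uniqueness for pair potentials at spectral high temperature** ([BB19] Theorem 1 + [Mar99]
Theorem 3.3 (b)–(c), both discharged in the tree): for `0 < β` with `2β Σ_{z≠0}|J z| ≤ 2βS < 1` there are
`α, l₀ > 0` with `SMT(B_L, l₀, α)` for every cube `B_L = [−L, L]^d` (exponential decay of finite-volume covariances
uniformly in the boundary condition, [Mar99] Def 2.6), and the pair potential has exactly one infinite-volume Gibbs
measure. [cite: Martinelli1999, Theorem 3.3] -/
theorem pair_SMT_unique {S β : ℝ} (hS : ∑ z ∈ (rNeighbourhood r 0).erase 0, |J z| ≤ S) (hS0 : 0 < S)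
    (hβ : 0 < β) (hβS : 2 * S * β < 1) :
    (∃ α l₀ : ℝ, 0 < α ∧ 0 < l₀ ∧ ∀ L : ℕ, SMT ((pair J h₀ hr).spec β) (centeredCube d L) l₀ α) ∧
      HasUniqueGibbsMeasure ((pair J h₀ hr).spec β) :=
  Glauber.Martinelli1999_thm3_3_holds (pair J h₀ hr) β
    ⟨_, fun L τ => pair_logSobolevIneq J h₀ hr hS hS0 hβ hβS (centeredCube d L) τ⟩

end Main

/-! ### §6. The nearest-neighbour Ising model on `ℤ^d`: `4 d J β < 1` -/

section NearestNeighbour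

variable (d)

/-- The nearest-neighbour coupling on `ℤ^d`: `J(z) = J_c` if `z ∼ 0` (`‖z‖₁ = 1`), else `0`.
[cite: Martinelli1999, §2.1 (the Ising model)] -/
def nnCoupling (Jc : ℝ) : Site d → ℝ := fun z => if (zdGraph d).Adj 0 z then Jc else 0

/-- The nearest-neighbour coupling has range `1` in the sup-distance. [cite: Martinelli1999, §2.1] -/
theorem nnCoupling_range (Jc : ℝ) : ∀ x y : Site d, 1 < supDist x y → nnCoupling d Jc (y - x) = 0 := by
  intro x y hxy
  unfold nnCoupling
  rw [if_neg]
  intro hadj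
  have h1 : supDist (0 : Site d) (y - x) ≤ 1 := (zdStar_adj.1 (zdGraph_le_zdStar hadj)).2
  rw [supDist_comm, supDist_sub_zero, supDist_comm] at h1
  exact absurd hxy (not_lt.2 h1)

/-- **The nearest-neighbour Ising model on `ℤ^d`** with coupling `J_c` and field `h₀`, `H_Λ(σ) = −J_c Σ_{⟨xy⟩∩Λ≠∅}
σ_x σ_y − h₀ Σ_{x∈Λ} σ_x`, as a range-1 pair potential. [cite: Martinelli1999, §2.1 (the Ising model)] -/
def nnIsing (Jc h₀ : ℝ) : FRPotential d ℤˣ 1 := pair (nnCoupling d Jc) h₀ (nnCoupling_range d Jc)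

/-- `Σ_{z≠0} |J(z)| ≤ 2d |J_c|` (the `2d` neighbours of the origin). [cite: Martinelli1999, §2.1] -/
theorem sum_abs_nnCoupling_le (Jc : ℝ) :
    ∑ z ∈ (rNeighbourhood 1 (0 : Site d)).erase 0, |nnCoupling d Jc z| ≤ 2 * d * |Jc| := by
  classical
  set R := (rNeighbourhood 1 (0 : Site d)).erase 0 with hR
  have h1 : ∑ z ∈ R, |nnCoupling d Jc z| = ∑ z ∈ R.filter (fun z => (zdGraph d).Adj 0 z), |Jc| := by
    rw [sum_filter]
    refine sum_congr rfl fun z _ => ?_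
    unfold nnCoupling
    split_ifs <;> simp
  rw [h1, sum_const, nsmul_eq_mul]
  have hcard : (R.filter (fun z => (zdGraph d).Adj 0 z)).card ≤ 2 * d := by
    calc (R.filter (fun z => (zdGraph d).Adj 0 z)).card ≤ ((zdGraph d).neighborFinset 0).card :=
          card_le_card fun z hz => (SimpleGraph.mem_neighborFinset _ _ _).2 (mem_filter.1 hz).2
      _ = 2 * d := card_neighborFinset_zdGraph_holds 0
  have : ((R.filter (fun z => (zdGraph d).Adj 0 z)).card : ℝ) ≤ 2 * d := by exact_mod_cast hcard
  nlinarith [abs_nonneg Jc]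

/-- **Uniform log-Sobolev inequality for the nearest-neighbour Ising model on `ℤ^d` when `4 d J_c β < 1`**
([BB19] Theorem 1: the coupling matrix `−βJ_c·(adjacency of Λ)` has spectral width `≤ 4dJ_cβ`): for every finite
`Λ` and every boundary condition, `c_s(μ_Λ^τ) ≤ (1 + 2β′/(1−β′))/2` with `β′ = 4dJ_cβ`.
[cite: BauerschmidtBodineau2019, Theorem 1] -/
theorem nnIsing_logSobolevIneq {Jc β : ℝ} (h₀ : ℝ) (hd : 0 < d) (hJc : 0 < Jc) (hβ : 0 < β)
    (h4 : 4 * d * Jc * β < 1) (Λ : Finset (Site d)) (τ : Site d → ℤˣ) :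
    Glauber.LogSobolevIneq ((nnIsing d Jc h₀).spec β Λ τ) Λ ((1 + 2 * (4 * d * Jc * β) / (1 - 4 * d * Jc * β)) / 2) := by
  have hS := sum_abs_nnCoupling_le d Jc
  rw [abs_of_pos hJc] at hS
  have hd' : (0 : ℝ) < d := by exact_mod_cast hd
  have hS0 : 0 < 2 * (d : ℝ) * Jc := by positivity
  have hβS : 2 * (2 * (d : ℝ) * Jc) * β < 1 := by linarith
  have h := pair_logSobolevIneq (nnCoupling d Jc) h₀ (nnCoupling_range d Jc) hS hS0 hβ hβS Λ τ
  have e : 2 * (2 * (d : ℝ) * Jc) * β = 4 * d * Jc * β := by ring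
  rw [e] at h
  exact h

/-- **Complete-analyticity-type conclusion for the nearest-neighbour Ising model at `4 d J_c β < 1`**: strong mixing
`SMT(B_L, l₀, α)` on all cubes with one pair `(l₀, α)`, and a unique infinite-volume Gibbs measure ([BB19] Theorem 1
+ [Mar99] Theorem 3.3 (b)–(c)). [cite: Martinelli1999, Theorem 3.3] -/
theorem nnIsing_SMT_unique {Jc β : ℝ} (h₀ : ℝ) (hd : 0 < d) (hJc : 0 < Jc) (hβ : 0 < β)
    (h4 : 4 * d * Jc * β < 1) :
    (∃ α l₀ : ℝ, 0 < α ∧ 0 < l₀ ∧ ∀ L : ℕ, SMT ((nnIsing d Jc h₀).spec β) (centeredCube d L) l₀ α) ∧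
      HasUniqueGibbsMeasure ((nnIsing d Jc h₀).spec β) := by
  have hS := sum_abs_nnCoupling_le d Jc
  rw [abs_of_pos hJc] at hS
  have hd' : (0 : ℝ) < d := by exact_mod_cast hd
  have hS0 : 0 < 2 * (d : ℝ) * Jc := by positivity
  have hβS : 2 * (2 * (d : ℝ) * Jc) * β < 1 := by linarith
  exact pair_SMT_unique (nnCoupling d Jc) h₀ (nnCoupling_range d Jc) hS hS0 hβ hβS

end NearestNeighbour

end FRPotential

end Literature.Probability.LatticeModels

end
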